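import Summits.ABC.ABC.Cruxes.PrimePowerRadical.Disproof

/-!
# Sketch (ideator 1, crux stmt-ABC-1648 `PrimePowerRadical`) — first lemmas of the idea cards

Typed shadows over existing declarations only (`Summit.ABC.ABC.Theses.IneffectiveSubspace.PrimePowerRadical`,
`Summit.ABC.ABC.Cruxes.PrimePowerRadical.Disproof.{PPRAt, oddWieferichExcess, WieferichSparse, wieferichLevel}`,
`Literature.NumberTheory.DiophantineGeometry.IsWieferich`, Mathlib `Nat.factorization`, `radical`).
Nothing is proved here; every `def … : Prop` is a statement the crux-plan seat turns into a stub or a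
support lemma.
-/

noncomputable section

set_option linter.dupNamespace false

namespace Summit.ABC.ABC.Cruxes.PrimePowerRadical.Ideator1

open Literature.NumberTheory.DiophantineGeometry UniqueFactorizationMonoid
open Summit.ABC.ABC.Theses.IneffectiveSubspace
open Summit.ABC.ABC.Cruxes.PrimePowerRadical.Disproof
open scoped BigOperators

/-- Excess of `m` captured by a depth-`n` detector: `Σ_p (min(v_p m, n) − 1) log p`
(`ℕ`-subtraction is honest: `v_p m ≥ 1` on `m.primeFactors`, `n ≥ 1` in use). On Yasufuku-type towers
`X'_n` this is `Σ_{i=2}^{n} N_{v∉S}(E_i, P_k)` for the auxiliary point `P_k = [q^k : rad(powerful part) : 1]`. -/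
def capturedExcess (n m : ℕ) : ℝ :=
  ∑ p ∈ m.primeFactors, ((min (m.factorization p) n - 1 : ℕ) : ℝ) * Real.log p

/-- The deep tail beyond depth `n`: `Σ_p (v_p m − n)⁺ log p` (primes with `p^{n+1} ∣ m`). -/
def deepTail (n m : ℕ) : ℝ :=
  ∑ p ∈ m.primeFactors, ((m.factorization p - n : ℕ) : ℝ) * Real.log p

/-- The full powerful excess `log (m / rad m) = Σ_p (v_p m − 1) log p`. -/
def logExcess (m : ℕ) : ℝ :=
  ∑ p ∈ m.primeFactors, ((m.factorization p - 1 : ℕ) : ℝ) * Real.log p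

/-- FIRST LEMMA (card `detector-geometry-lp`): the excess splits exactly into the part a depth-`n`
detector sees and the deep tail, and equals `log(m / rad m)`. Elementary (`min v n − 1 + (v − n)⁺ = v − 1`
for `v ≥ 1`, `n ≥ 1`; `m = rad m · ∏ p^{v_p − 1}`). -/
def ExcessSplit : Prop :=
  ∀ n m : ℕ, 1 ≤ n → 1 ≤ m →
    logExcess m = capturedExcess n m + deepTail n m ∧
    Real.log ((m : ℝ) / ((radical m : ℕ) : ℝ)) = logExcess m

/-- A power-saving excess bound at base `q` with exponent `θ`: `E_W(q,k) ≤ C · q^{θ k}` for all `k ≥ 1`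
(`θ = ε` for every `ε > 0` is `WieferichSparse q`, i.e. the crux at `q`, `PPRAt_iff_wieferichSparse`). -/
def ThetaExcessBound (q : ℕ) (θ : ℝ) : Prop :=
  ∃ C : ℝ, 0 < C ∧ ∀ k : ℕ, 1 ≤ k → (oddWieferichExcess q k : ℝ) ≤ C * (q : ℝ) ^ (θ * k)

/-- FIRST LEMMA (card `nevbir-below-beta`): ANY exponent `θ < 1/2` already gives infinitely many
non-Wieferich primes to base `q` (Silverman's conclusion), because "all large primes Wieferich" forces
`rad(q^k − 1) ∣ C₀ · E_W(q,k)` (`radical_dvd_of_eventually_wieferich`) and then the upper sandwich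
`q^k − 1 ∣ k · rad · E_W · 2^{W_2}` (`dvd_mul_oddWieferichExcess`) gives `E_W(q,k) ≥ c q^{k/2}/√k`.
This is why a `θ`-output of the geometric line is news although it is not yet the crux. -/
def InfiniteNonWieferichOfThetaLtHalf : Prop :=
  ∀ q : ℕ, q.Prime → ∀ θ : ℝ, θ < 1 / 2 → ThetaExcessBound q θ →
    {p : ℕ | p.Prime ∧ ¬ IsWieferich q p}.Infinite

/-- The crux is the `θ → 0` limit of `ThetaExcessBound` (both directions; `→` is `ε/2`-bookkeeping with
`PPRAt_of_wieferichSparse`, `←` is `wieferichSparse_of_PPRAt`). -/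
def CruxIffThetaToZero : Prop :=
  (∀ q : ℕ, q.Prime → ∀ θ : ℝ, 0 < θ → ThetaExcessBound q θ) ↔ PrimePowerRadical

/-- Output shape of a depth-`n` detector surface with constant `θ` (what an improved Ru–Vojta constant on
`X'_n` would deliver for the auxiliary points): captured excess `≤ θ k log q + C`. -/
def DetectorOutput (q n : ℕ) (θ : ℝ) : Prop :=
  ∃ C : ℝ, ∀ k : ℕ, 1 ≤ k → capturedExcess n (q ^ k - 1) ≤ θ * k * Real.log q + C

/-- The deep-tail residual beyond depth `n` (width of depth-`(n+1)` Wieferich primes plus the `p ∣ k`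
junk, which is `≤ log k` by `padicValNat_family`): `≤ ε k log q + C`. -/
def DeepTailBound (q n : ℕ) (ε : ℝ) : Prop :=
  ∃ C : ℝ, ∀ k : ℕ, 1 ≤ k → deepTail n (q ^ k - 1) ≤ ε * k * Real.log q + C

/-- COMPOSITION SHAPE of the line (the future `PrimePowerRadical_of`): detector outputs with `θ_n → 0`
plus vanishing deep tails give the crux (via `ExcessSplit` and `rad(1·(q^k−1)·q^k) = q · rad(q^k − 1)`,
`rad_family_eq`). -/
def CruxOfDetectorTower : Prop :=
  (∀ q : ℕ, q.Prime → ∀ ε : ℝ, 0 < ε →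
      ∃ n : ℕ, 1 ≤ n ∧ ∃ θ : ℝ, 0 ≤ θ ∧ θ ≤ ε ∧ DetectorOutput q n θ ∧ DeepTailBound q n ε) →
    PrimePowerRadical

/-- CALIBRATION (card `detector-geometry-lp`, the certified tangency on the chamber `c̄ ∈ (1/2,1)` of the
big cone of `X_2'`): with Ru–Vojta's constants `β_H = (1 − c̄)/3`, `β_Y = 2(1 − c̄)/3` the LP output is
EXACTLY the trivial exponent `1/2` — the identity below (pure real arithmetic; the content is that these are
the `β`'s, kit jobs j008034/j008580/j009008). -/
def TangencyIdentity : Prop :=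
  ∀ c : ℝ, 1 / 2 < c → c < 1 →
    (1 - 2 * ((1 - c) / 3) - 2 * (1 - c) / 3) / (2 * c - 2 * (1 - c) / 3) = 1 / 2

example : TangencyIdentity := by
  intro c hc hc'
  have h : 2 * c - 2 * (1 - c) / 3 ≠ 0 := by nlinarith
  rw [div_eq_iff h]
  ring

end Summit.ABC.ABC.Cruxes.PrimePowerRadical.Ideator1
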